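import Literature.MeasureTheory.Group.CosetAveraging
import Mathlib.MeasureTheory.Function.L1Space.Integrable
import HarnessLib

/-!
# Averaging a coset-constant factor out of a LOWER LEBESGUE integral over `A × G`; integrability of the
# invariant factor

Topic `MeasureTheory/Group`; namespace `Literature.MeasureTheory.Group`. Theorems only. The `ℝ≥0∞`
companion of `CosetAveraging`: with `μ = ν_A × ν_G` (`ν_G` right invariant, both s-finite), a finite group
`Q`, a label `c : A × G → Q` equivariant for right translation by representatives `ρ q`
(`c (a, g ρ(q)) = c (a, g) · q`) and a translation invariant `Γ : A × G → ℝ≥0∞`,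

  `∫⁻_{S × G} F(c p) Γ(p) dμ = ((#Q)⁻¹ ∑_q F q) · ∫⁻_{S × G} Γ(p) dμ`

(`setLIntegral_mul_eq_avg_mul_setLIntegral`; no integrability hypothesis, `Γ` a.e.-measurable on
`S × G`). Consequence (`integrableOn_of_integrableOn_fiberConst_mul`): if `p ↦ F(c p) Γ(p)` is
integrable on `S × G` for a complex `Γ` invariant under the translations and `F 1 ≠ 0`, then `Γ` itself is
integrable on `S × G` — the average of `‖F‖` is then positive.

## References

Standard measure theory (change of variables for measure-preserving equivalences, Mathlib
`MeasureTheory.MeasurePreserving.setLIntegral_comp_preimage_emb`). [folklore]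
-/

noncomputable section

open MeasureTheory MeasureTheory.Measure Set Filter
open scoped ENNReal

namespace Literature.MeasureTheory.Group

variable {A G Q : Type*} [MeasurableSpace A] [Group G] [MeasurableSpace G] [MeasurableMul G]
  [Group Q]

/-- **The pieces `{c = q}` of `S × G` carry the same lower integral of a translation-invariant
function** (`ℝ≥0∞` version of `setIntegral_inter_fiber_eq`; no measurability needed). [folklore] -/
theorem setLIntegral_inter_fiber_eq (νA : Measure A) [SFinite νA] (νG : Measure G) [SFinite νG]
    [νG.IsMulRightInvariant] {c : A × G → Q} (ρ : Q → G)
    (hρ : ∀ (p : A × G) (q : Q), c (p.1, p.2 * ρ q) = c p * q) (S : Set A)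
    (Γ : A × G → ℝ≥0∞) (hΓ : ∀ (p : A × G) (q : Q), Γ (p.1, p.2 * ρ q) = Γ p) (q : Q) :
    ∫⁻ p in (S ×ˢ (univ : Set G)) ∩ c ⁻¹' {q}, Γ p ∂(νA.prod νG) =
      ∫⁻ p in (S ×ˢ (univ : Set G)) ∩ c ⁻¹' {1}, Γ p ∂(νA.prod νG) := by
  set e : A × G ≃ᵐ A × G := MeasurableEquiv.prodCongr (MeasurableEquiv.refl A) (MeasurableEquiv.mulRight (ρ q))
    with he
  have hea : ∀ p : A × G, e p = (p.1, p.2 * ρ q) := fun p => rfl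
  have hmp : MeasurePreserving e (νA.prod νG) (νA.prod νG) := by
    have h := (MeasurePreserving.id νA).prod (measurePreserving_mul_right νG (ρ q))
    have hfun : (⇑e : A × G → A × G) = Prod.map id fun x => x * ρ q := funext fun p => rfl
    rw [hfun]
    exact h
  have hpre : e ⁻¹' ((S ×ˢ (univ : Set G)) ∩ c ⁻¹' {q}) = (S ×ˢ (univ : Set G)) ∩ c ⁻¹' {1} := by
    ext p
    simp only [mem_preimage, mem_inter_iff, mem_prod, mem_univ, and_true, mem_singleton_iff, hea, hρ]
    constructor
    · rintro ⟨hS, hcq⟩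
      exact ⟨hS, mul_right_cancel (a := c p) (b := q) (c := 1) (by rw [one_mul]; exact hcq)⟩
    · rintro ⟨hS, hc1⟩
      exact ⟨hS, by rw [hc1, one_mul]⟩
  have h := hmp.setLIntegral_comp_preimage_emb e.measurableEmbedding Γ ((S ×ˢ (univ : Set G)) ∩ c ⁻¹' {q})
  rw [hpre] at h
  rw [← h]
  refine lintegral_congr fun p => ?_
  rw [hea, hΓ]

/-- **Averaging a coset-constant factor out of a lower integral.** With `c`, `ρ`, `Γ` as in
`setLIntegral_inter_fiber_eq`, `Γ` a.e.-measurable on `S × G` and measurable fibres `{c = q}`: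
`∫⁻_{S × G} F(c p) Γ(p) = ((#Q)⁻¹ ∑_q F q) · ∫⁻_{S × G} Γ`. [folklore] -/
theorem setLIntegral_mul_eq_avg_mul_setLIntegral [Fintype Q] [DecidableEq Q]
    (νA : Measure A) [SFinite νA] (νG : Measure G) [SFinite νG]
    [νG.IsMulRightInvariant] {c : A × G → Q} (hc : ∀ q, MeasurableSet (c ⁻¹' {q})) (ρ : Q → G)
    (hρ : ∀ (p : A × G) (q : Q), c (p.1, p.2 * ρ q) = c p * q) (S : Set A)
    (F : Q → ℝ≥0∞) {Γ : A × G → ℝ≥0∞}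
    (hΓm : AEMeasurable Γ ((νA.prod νG).restrict (S ×ˢ (univ : Set G))))
    (hΓ : ∀ (p : A × G) (q : Q), Γ (p.1, p.2 * ρ q) = Γ p) :
    ∫⁻ p in S ×ˢ (univ : Set G), F (c p) * Γ p ∂(νA.prod νG) =
      ((Fintype.card Q : ℝ≥0∞)⁻¹ * ∑ q, F q) * ∫⁻ p in S ×ˢ (univ : Set G), Γ p ∂(νA.prod νG) := by
  set μ := νA.prod νG with hμ
  set T : Set (A × G) := S ×ˢ (univ : Set G) with hT
  set J : Q → ℝ≥0∞ := fun q => ∫⁻ p in T ∩ c ⁻¹' {q}, Γ p ∂μ with hJ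
  have hJ1 : ∀ q, J q = J 1 := fun q => setLIntegral_inter_fiber_eq νA νG ρ hρ S Γ hΓ q
  have hmq : ∀ q, AEMeasurable Γ (μ.restrict (c ⁻¹' {q} ∩ T)) := fun q =>
    hΓm.mono_measure (Measure.restrict_mono inter_subset_right le_rfl)
  -- `∫⁻_T Γ = ∑_q J q = #Q · J 1`
  have hsumΓ : ∫⁻ p in T, Γ p ∂μ = ∑ q, J q := by
    have hpt : (fun p => Γ p) = fun p => ∑ q, (c ⁻¹' {q}).indicator Γ p := by
      funext p
      rw [sum_indicator_fiber_apply c (fun _ => Γ) p]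
    rw [hpt, lintegral_finsetSum' _ (fun q _ => hΓm.indicator (hc q))]
    refine Finset.sum_congr rfl fun q _ => ?_
    rw [setLIntegral_indicator (hc q), Set.inter_comm]
  have hcard0 : (Fintype.card Q : ℝ≥0∞) ≠ 0 := Nat.cast_ne_zero.2 Fintype.card_ne_zero
  have hcardt : (Fintype.card Q : ℝ≥0∞) ≠ ⊤ := ENNReal.natCast_ne_top _
  have hJ1eq : J 1 = (Fintype.card Q : ℝ≥0∞)⁻¹ * ∫⁻ p in T, Γ p ∂μ := by
    rw [hsumΓ, Finset.sum_congr rfl (fun q (_ : q ∈ Finset.univ) => hJ1 q), Finset.sum_const,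
      Finset.card_univ, nsmul_eq_mul, ← mul_assoc, ENNReal.inv_mul_cancel hcard0 hcardt, one_mul]
  -- `∫⁻_T F(c p) Γ p = ∑_q F q · J q`
  have hsumF : ∫⁻ p in T, F (c p) * Γ p ∂μ = ∑ q, F q * J q := by
    have hpt : (fun p => F (c p) * Γ p) = fun p => ∑ q, (c ⁻¹' {q}).indicator (fun p => F q * Γ p) p := by
      funext p
      rw [sum_indicator_fiber_apply c (fun q p => F q * Γ p) p]
    rw [hpt, lintegral_finsetSum' _ (fun q _ => (hΓm.const_mul (F q)).indicator (hc q))]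
    refine Finset.sum_congr rfl fun q _ => ?_
    rw [setLIntegral_indicator (hc q), lintegral_const_mul'' _ (hmq q), Set.inter_comm]
  rw [hsumF, Finset.sum_congr rfl (fun q (_ : q ∈ Finset.univ) => by rw [hJ1 q]), ← Finset.sum_mul, hJ1eq]
  ring

/-- **Integrability of the invariant factor from integrability of the product.** With `c`, `ρ` as
above, `Γ : A × G → ℂ` invariant under the translations and a.e.-strongly measurable on `S × G`, and
`F : Q → ℂ` with `F 1 ≠ 0`: if `p ↦ F(c p) Γ(p)` is integrable on `S × G`, so is `Γ`
(`∫⁻ ‖F(c p)‖ ‖Γ(p)‖ = ((#Q)⁻¹ ∑_q ‖F q‖) ∫⁻ ‖Γ‖` with a positive average). [folklore] -/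
theorem integrableOn_of_integrableOn_fiberConst_mul [Fintype Q] [DecidableEq Q]
    (νA : Measure A) [SFinite νA] (νG : Measure G) [SFinite νG]
    [νG.IsMulRightInvariant] {c : A × G → Q} (hc : ∀ q, MeasurableSet (c ⁻¹' {q})) (ρ : Q → G)
    (hρ : ∀ (p : A × G) (q : Q), c (p.1, p.2 * ρ q) = c p * q) (S : Set A)
    (F : Q → ℂ) (hF1 : F 1 ≠ 0) {Γ : A × G → ℂ}
    (hΓm : AEStronglyMeasurable Γ ((νA.prod νG).restrict (S ×ˢ (univ : Set G))))
    (hΓ : ∀ (p : A × G) (q : Q), Γ (p.1, p.2 * ρ q) = Γ p)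
    (hint : IntegrableOn (fun p => F (c p) * Γ p) (S ×ˢ (univ : Set G)) (νA.prod νG)) :
    IntegrableOn Γ (S ×ˢ (univ : Set G)) (νA.prod νG) := by
  refine ⟨hΓm, ?_⟩
  have key := setLIntegral_mul_eq_avg_mul_setLIntegral νA νG hc ρ hρ S (fun q => ‖F q‖ₑ)
    (Γ := fun p => ‖Γ p‖ₑ) hΓm.enorm (fun p q => by rw [hΓ])
  have hlhs : ∫⁻ p in S ×ˢ (univ : Set G), ‖F (c p)‖ₑ * ‖Γ p‖ₑ ∂(νA.prod νG) < ⊤ := by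
    have h := hint.2
    simp only [HasFiniteIntegral, enorm_mul] at h
    exact h
  rw [key] at hlhs
  have havg : ((Fintype.card Q : ℝ≥0∞)⁻¹ * ∑ q, ‖F q‖ₑ) ≠ 0 := by
    refine mul_ne_zero (ENNReal.inv_ne_zero.2 (ENNReal.natCast_ne_top _)) fun h0 => ?_
    have h1 : ‖F 1‖ₑ = 0 := (Finset.sum_eq_zero_iff.1 h0) 1 (Finset.mem_univ _)
    exact hF1 (enorm_eq_zero.1 h1)
  rcases ENNReal.mul_lt_top_iff.1 hlhs with ⟨-, h⟩ | h | h
  · exact h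
  · exact absurd h havg
  · simp only [HasFiniteIntegral, h]
    exact ENNReal.zero_lt_top

end Literature.MeasureTheory.Group
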